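import Summits.BirchSwinnertonDyer.BirchSwinnertonDyer.Theorems.ClassRecordThreeEulerHalvesAtThreeLeafOfExceptionalZeroRoad

/-!
# Route `ClassRecordThree` (rung K2@3): the exceptional-zero road RE-KEYED on «conj@3-WITH-m» — the
# exceptional display on split X11b@3 ∩ `Surj` pairs WITH A SECOND MULTIPLICATIVE PRIME (the object the
# cell audited: Disegni 2020 Thm. 4 second bullet read at `p = 3`), the `3`-only split pairs isolated as
# an explicit Euler-half residue (cell `bsd-stepL`, seat `bsd-stepL-mult-p4` g4;
# `--supports stmt-BirchSwinnertonDyer-19109`)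

Cell `bsd-stepL` (D-0131 (3) middle tier, seat `bsd-stepL-mult-p4`, lens «split-multiplicative
`r = 1` via the 𝓛-invariant `p`-adic Gross–Zagier + Kobayashi 2006»). THEOREMS ONLY, CONDITIONAL on
the PUBLISHED named facts in the binders and on the typed inputs named below; no definition, no new
fact, no `sorry`; nothing about any curve is asserted and no census word moves (TARGET T7).

## What

Gens 2–3 (p545447, p552549) supply crux 5 `EulerHalvesAtThree` (item 19109) and the rung-K2@3 leaf
`X11b.MultiplicativeRankOneAtThree` from the exceptional display
`ClassClosure.RelativeExceptionalLeadingTermAt W 3` assumed on ALL split X11b@3 ∩ `Surj` pairs (`hC`).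
The cell's audit (memos `HOME/mult-p4/EXZ-ROAD-MEMO-g2…g4.md`; lit sheets
`HOME/audit/VB3-GS93-S5S6-AT-3-lit-g28.md`, `B1-HIDA-AT-3-lit-g28.md`) grades that display DIFFERENTLY on
two sub-loci: on pairs with a SECOND multiplicative prime `ℓ ≠ 3` («conj@3-with-m»: Disegni 2020 Thm. 4,
second bullet, exact form = Venerucci 2016 Thm. D + Bertolini–Darmon 2007 Thm. 5.4 + Disegni Props. 4–5,
every brick of whose printed `p ≥ 5` proof is located in print at `p = 3` or supplied — Hida control:
Hida EMI Thms. 4.1.24 ∕ 4.2.37 ∕ 4.2.47; Greenberg–Stevens §§5–6 «p > 0» with (5.13)'s two Hida inputs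
re-sourced; Mazur–Tilouine Thm. 7, Ochiai, Kobayashi 2006 at `p ≥ 3`; BD07's body and Disegni's
Props. 4–5 prime-free; the quaternionic family BD07 Thm. 2.5 at `3` by an auxiliary neat level and a
characteristic-`0` descent) and on `3`-ONLY pairs (`3` the unique multiplicative prime: Mok 2011 ∕
Disegni Thm. 4 give the display only up to `ℚ^×` — a period-commensurability conjecture, beyond print
at every `p`). This file re-keys the road on exactly that partition:

* `hCm` — conj@3-WITH-m: the display on split X11b@3 ∩ `Surj` pairs having a multiplicative prime
  `ℓ ≠ 3` (no condition on `v_ℓ(Δ)`: BD07 ∕ Disegni need `ℓ ∥ N` only);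
* `h₃` — the `3`-ONLY residue: the Euler half `Typed.MissingUpperBoundAt W 3` itself on split
  ¬(ram) ∩ `Surj` pairs with NO multiplicative prime `ℓ ≠ 3` (supplier-agnostic: on the cell's census
  of record the (T2′)@3 TRUE-OPEN B10 classes are ALL (ram), so this binder is idle there; class-wide
  it is the honest remainder of the road).

Every (ram) pair HAS a second multiplicative prime — `Ram W 3` posits a multiplicative `ℓ ≠ 3` with
`3 ∤ v_ℓ(Δ_min)` (`Three.exists_multiplicativePrime_ne_of_ram`) — so clauses (1)–(2) of crux 19109 and
the three (ram) binders `hUβ`, `hUα`, `hUγ` of the kernel class record need `hCm` ONLY; clause (3) and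
`hU₀` split into `hCm` (second prime present) and `h₃` (absent); non-split pairs are unchanged
(Disegni 2020 Thm. 1 non-split clause, PUBLISHED at every odd `p`, + the non-split Schneider half).

## Results (namespace `…Theorems.ExceptionalZeroRoad`)

§1 `Three.exists_multiplicativePrime_ne_of_ram`; `Three.eulerHalves_ramClauses_of_conjectureWithM_of_schneiderSplit`
(clauses (1)–(2) from `hCm` + the split Schneider half); §2
`classRecordThree_eulerHalvesAtThree_of_conjectureWithM_of_threeOnly_of_schneider` (the crux BY NAME) +
the `KolyvaginRoadThree` twin + the `PublishedInputsThree` packaging; §3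
`multiplicativeRankOneAtThree_of_cruxes_of_conjectureWithM_of_threeOnly_of_schneider` (the leaf from
`SchneiderAtThree` + `HalvesAtThreeR` + `HsiehDescentAtThree` + `CornerAtThree` + `PublishedInputsThree`
BY NAME, crux 5 and the Shimura package replaced as in p552549) + `…_of_closesBinders_…`.

## Reading (numbers of record, TARGET §2; nothing moves)

On the 961 TRUE-OPEN split ∧ (ram) B10 classes the road's analytic input is conj@3-WITH-m on every
pair (m = the (ram) prime); the `3`-only binder `h₃` bears on no TRUE-OPEN class of the census and on
the class-wide `3`-only split pairs only. CONDITIONAL; closes nothing; the registered lines of 19109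
(`hybrid` of record, `birth`, `exz`) are untouched.

References: [Disegni2020] Thm. 1 (§1.2) = Thm. 4 (§3.2), Props. 4–5; [Venerucci2015] Thm. D;
[BertoliniDarmon2007] Thms. 2.5, 5.4; [Mok2011] (Hilbert-modular extension, `ℚ^×`); [Wuthrich2014]
Thm. 3, Cor. 19; [SteinWuthrich2013] Thm. 6.1, §4.2; [MazurTateTeitelbaum1986Invent] §II.10;
[Miller2011LMS] Def. 1.1; cell files HOME/mult-p4/EXZ-ROAD-MEMO-g0…g4.md.
-/

set_option autoImplicit false

-- Theorems files of this problem live in `Summit.BirchSwinnertonDyer.BirchSwinnertonDyer.Theorems.*`.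
set_option linter.dupNamespace false

noncomputable section

open scoped Classical MatrixGroups ModularForm

open CongruenceSubgroup WeierstrassCurve Literature.NumberTheory.EllipticCurves
  Literature.NumberTheory.EllipticCurves.ModularForms
  Literature.NumberTheory.EllipticCurves.Rank1Residual
  Literature.NumberTheory.EllipticCurves.Rank1Residual.Typed
  Literature.NumberTheory.EllipticCurves.SteinWuthrich2013
  Literature.NumberTheory.EllipticCurves.Wuthrich2014

namespace Summit.BirchSwinnertonDyer.BirchSwinnertonDyer.Theorems.ExceptionalZeroRoad

open Summit.BirchSwinnertonDyer.Rank1Residual Summit.BirchSwinnertonDyer.Rank1Residual.X11b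
  Summit.BirchSwinnertonDyer.Rank1Residual.X11b.Three
  Summit.BirchSwinnertonDyer.BirchSwinnertonDyer.Theses.ClassRecordThree

/-! ### §1 Pairs and the two (ram) clauses -/

section Pair

variable (W : WeierstrassCurve ℚ) [W.IsElliptic] [W.IsGloballyMinimal]

omit [W.IsElliptic] in
/-- **A (ram) witness at `3` IS a second multiplicative prime**: `Ram W 3` posits a prime `ℓ ≠ 3` of
multiplicative reduction (with `3 ∤ v_ℓ(Δ_min)`, not needed here) — the hypothesis «`N ∕ p` not
square-full» of Venerucci 2016 Rem. 2.2 ∕ the prime `m` of Disegni 2020 Prop. 5 on every (ram) pair.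
[cite: SkinnerUrban2014, Thm. 2 (p. 3), second bullet] [cite: Disegni2020, §3.2 Prop. 5] -/
theorem Three.exists_multiplicativePrime_ne_of_ram (hram : Ram W 3) :
    ∃ ℓ : ℕ, ∃ _ : Fact ℓ.Prime, ℓ ≠ 3 ∧ W.HasMultiplicativeReductionAtPrime ℓ := by
  obtain ⟨ℓ, hℓ, hne, hmult, -⟩ := hram
  exact ⟨ℓ, hℓ, hne, hmult⟩

/-- **SPLIT X11b@3 ∩ `Surj` pair WITH a second multiplicative prime: the Euler half from conj@3-WITH-m.**
Kato–Wuthrich surjective divisibility (`hKato`), SW Thm. 6.1 split (`hJs`), the split canonical height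
(`hHs`), GZK, a modular parametrisation — PUBLISHED — read through the display `hCm` at the pair (the
audited object: Disegni 2020 Thm. 4 second bullet at `p = 3`, second prime `ℓ`) and the split Schneider
half (`hSch`). CONDITIONAL on `hCm`; nothing booked. [cite: Disegni2020, Thm. 4 (§3.2) second bullet, Prop. 5]
[cite: Wuthrich2014, Thm. 3 (p. 383), Cor. 19] [cite: SteinWuthrich2013, Thm. 6.1, §4.2 (p. 16)]
[cite: MazurTateTeitelbaum1986Invent, §II.10] [cite: Miller2011LMS, Def. 1.1] -/
theorem Three.missingUpperBoundAt_of_surj_split_of_secondPrime_of_conjectureWithM_of_schneiderSplit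
    (hKato : kato_charIdeal_dvd_multiplicative_of_surjective) (hJs : thm61_splitMultiplicative)
    (hHs : exists_isSplitMultCanonical) (hGZK : rank_eq_analyticRank_of_analyticRank_le_one)
    (hpar : nonempty_modularParametrizationData)
    (hX : ClassX11b W 3) (hsurj : Surj W 3) (hsplit : W.HasSplitMultiplicativeReductionAtPrime 3)
    (hm : ∃ ℓ : ℕ, ∃ _ : Fact ℓ.Prime, ℓ ≠ 3 ∧ W.HasMultiplicativeReductionAtPrime ℓ)
    (hCm : ∀ (W : WeierstrassCurve ℚ) [W.IsElliptic] [W.IsGloballyMinimal], ClassX11b W 3 → Surj W 3 →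
      W.HasSplitMultiplicativeReductionAtPrime 3 →
        (∃ ℓ : ℕ, ∃ _ : Fact ℓ.Prime, ℓ ≠ 3 ∧ W.HasMultiplicativeReductionAtPrime ℓ) →
          ClassClosure.RelativeExceptionalLeadingTermAt W 3)
    (hSch : ∀ (Dq : TateParameterData W 3) (Dh : PAdicHeightData W 3),
      IsSplitMultCanonical Dh Dq → SchneiderConjecture Dh) :
    Typed.MissingUpperBoundAt W 3 :=
  Three.missingUpperBoundAt_of_surj_split_of_conjecture_of_schneiderSplit W hKato hJs hHs hGZK hpar hX
    hsurj hsplit (hCm W hX hsurj hsplit hm) hSch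

end Pair

section Crux

/-- **Clauses (1) ∧ (2) of crux 19109 — the two (ram) clauses, both on the SPLIT-at-`3` locus — from
conj@3-WITH-m and the split Schneider half ONLY**: a (ram) witness is a second multiplicative prime
(`Three.exists_multiplicativePrime_ne_of_ram`) and forces `Surj W 3` (`surj_of_irr_of_ram`), so the
audited display `hCm` is the road's whole analytic input on the 961 TRUE-OPEN split ∧ (ram) B10 classes
(one split REGMULT row per pair for `hSchS`, 960∕961 CERT of record). Tamagawa shapes unused; no
Skinner–Urban statement. CONDITIONAL; nothing booked. [cite: Disegni2020, Thm. 4 (§3.2) second bullet, Prop. 5]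
[cite: Wuthrich2014, Thm. 3, Cor. 19] [cite: SteinWuthrich2013, Thm. 6.1, §4.2]
[cite: SerreInventiones1972, §2 Prop. 15] [cite: Miller2011LMS, Def. 1.1] -/
theorem Three.eulerHalves_ramClauses_of_conjectureWithM_of_schneiderSplit
    (hKato : kato_charIdeal_dvd_multiplicative_of_surjective) (hJs : thm61_splitMultiplicative)
    (hHs : exists_isSplitMultCanonical) (hGZK : rank_eq_analyticRank_of_analyticRank_le_one)
    (hpar : nonempty_modularParametrizationData)
    (hCm : ∀ (W : WeierstrassCurve ℚ) [W.IsElliptic] [W.IsGloballyMinimal], ClassX11b W 3 → Surj W 3 →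
      W.HasSplitMultiplicativeReductionAtPrime 3 →
        (∃ ℓ : ℕ, ∃ _ : Fact ℓ.Prime, ℓ ≠ 3 ∧ W.HasMultiplicativeReductionAtPrime ℓ) →
          ClassClosure.RelativeExceptionalLeadingTermAt W 3)
    (hSchS : ∀ (W : WeierstrassCurve ℚ) [W.IsElliptic] [W.IsGloballyMinimal], ClassX11b W 3 → Surj W 3 →
      W.HasSplitMultiplicativeReductionAtPrime 3 → ∀ (Dq : TateParameterData W 3) (Dh : PAdicHeightData W 3),
        IsSplitMultCanonical Dh Dq → SchneiderConjecture Dh) :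
    ∀ (W : WeierstrassCurve ℚ) [W.IsElliptic] [W.IsGloballyMinimal], ClassX11b W 3 →
      (Ram W 3 → ShapeAlpha W → Typed.MissingUpperBoundAt W 3) ∧
      (Ram W 3 → W.HasSplitMultiplicativeReductionAtPrime 3 → ¬ ShapeAlpha W → ShapeGamma W →
        Typed.MissingUpperBoundAt W 3) := by
  intro W _ _ hX
  have key : Ram W 3 → W.HasSplitMultiplicativeReductionAtPrime 3 → Typed.MissingUpperBoundAt W 3 :=
    fun hram hsplit ↦
      have hsurj : Surj W 3 := surj_of_irr_of_ram W 3 hX.2.2.2 hram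
      Three.missingUpperBoundAt_of_surj_split_of_secondPrime_of_conjectureWithM_of_schneiderSplit W hKato
        hJs hHs hGZK hpar hX hsurj hsplit (Three.exists_multiplicativePrime_ne_of_ram W hram) hCm
        (hSchS W hX hsurj hsplit)
  exact ⟨fun hram hα ↦ key hram hα.1, fun hram hsplit _ _ ↦ key hram hsplit⟩

/-- **Crux 19109 `EulerHalvesAtThree` of route `ClassRecordThree`, BY NAME, from the exceptional-zero
road keyed on conj@3-WITH-m.** Inputs: eight PUBLISHED named facts (`hKato`, `hJs`, `hJn`, `hHs`, `hHn`,
`hDf` — Disegni Thm. 1 through its NON-split clause only —, `hGZK`, `hpar`); the audited display `hCm`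
on split X11b@3 ∩ `Surj` pairs WITH a multiplicative `ℓ ≠ 3`; the `3`-ONLY residue `h₃` — the Euler
half itself on split ¬(ram) ∩ `Surj` pairs with NO multiplicative `ℓ ≠ 3` (the display there is in
print only up to `ℚ^×`; supplier-agnostic binder, idle on the census's TRUE-OPEN B10 classes, all
(ram)); and the two Schneider halves on their loci (`hSchS`, `hSchN`; rung I1 at `3`, per pair ONE
REGMULT row). (ram) clauses: `hCm` only (a (ram) witness is a second prime and gives `Surj`); clause
(3): non-split pairs PUBLISHED modulo `hSchN`, split pairs by `hCm` or `h₃`. CONDITIONAL; closes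
nothing; no Skinner–Urban statement (no FLAG `SU14-12.3.6-mu@nonsplit@3`).
[cite: Disegni2020, Thm. 1 (§1.2) = Thm. 4 (§3.2), Prop. 5] [cite: Wuthrich2014, Thm. 3 (p. 383), Cor. 19]
[cite: SteinWuthrich2013, Thm. 6.1, §4.2] [cite: MazurTateTeitelbaum1986Invent, §II.10]
[cite: Miller2011LMS, Def. 1.1] -/
theorem classRecordThree_eulerHalvesAtThree_of_conjectureWithM_of_threeOnly_of_schneider
    (hKato : kato_charIdeal_dvd_multiplicative_of_surjective) (hJs : thm61_splitMultiplicative)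
    (hJn : thm61_nonsplitMultiplicative) (hHs : exists_isSplitMultCanonical)
    (hHn : exists_isMultCanonical) (hDf : Disegni2020.thm1_padicBSD_rankOne_multiplicative)
    (hGZK : rank_eq_analyticRank_of_analyticRank_le_one) (hpar : nonempty_modularParametrizationData)
    (hCm : ∀ (W : WeierstrassCurve ℚ) [W.IsElliptic] [W.IsGloballyMinimal], ClassX11b W 3 → Surj W 3 →
      W.HasSplitMultiplicativeReductionAtPrime 3 →
        (∃ ℓ : ℕ, ∃ _ : Fact ℓ.Prime, ℓ ≠ 3 ∧ W.HasMultiplicativeReductionAtPrime ℓ) →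
          ClassClosure.RelativeExceptionalLeadingTermAt W 3)
    (h₃ : ∀ (W : WeierstrassCurve ℚ) [W.IsElliptic] [W.IsGloballyMinimal], ClassX11b W 3 → Surj W 3 →
      ¬ Ram W 3 → W.HasSplitMultiplicativeReductionAtPrime 3 →
        (∀ (ℓ : ℕ) [Fact ℓ.Prime], ℓ ≠ 3 → ¬ W.HasMultiplicativeReductionAtPrime ℓ) →
          Typed.MissingUpperBoundAt W 3)
    (hSchS : ∀ (W : WeierstrassCurve ℚ) [W.IsElliptic] [W.IsGloballyMinimal], ClassX11b W 3 → Surj W 3 →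
      W.HasSplitMultiplicativeReductionAtPrime 3 → ∀ (Dq : TateParameterData W 3) (Dh : PAdicHeightData W 3),
        IsSplitMultCanonical Dh Dq → SchneiderConjecture Dh)
    (hSchN : ∀ (W : WeierstrassCurve ℚ) [W.IsElliptic] [W.IsGloballyMinimal], ClassX11b W 3 → ¬ Ram W 3 →
      Surj W 3 → ¬ W.HasSplitMultiplicativeReductionAtPrime 3 →
        ∀ (q : ℚ_[3]) (Dh : PAdicHeightData W 3), q ≠ 0 → ‖q‖ < 1 → tateJ q = (W.j : ℚ_[3]) →
          IsMultCanonical Dh q → SchneiderConjecture Dh) :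
    Summit.BirchSwinnertonDyer.BirchSwinnertonDyer.Theses.ClassRecordThree.EulerHalvesAtThree := by
  intro W _ _ hX
  obtain ⟨h1, h2⟩ :=
    Three.eulerHalves_ramClauses_of_conjectureWithM_of_schneiderSplit hKato hJs hHs hGZK hpar hCm hSchS W hX
  refine ⟨h1, h2, fun hsurj hnr ↦ ?_⟩
  by_cases hsplit : W.HasSplitMultiplicativeReductionAtPrime 3
  · by_cases hm : ∃ ℓ : ℕ, ∃ _ : Fact ℓ.Prime, ℓ ≠ 3 ∧ W.HasMultiplicativeReductionAtPrime ℓ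
    · exact Three.missingUpperBoundAt_of_surj_split_of_secondPrime_of_conjectureWithM_of_schneiderSplit W
        hKato hJs hHs hGZK hpar hX hsurj hsplit hm hCm (hSchS W hX hsurj hsplit)
    · exact h₃ W hX hsurj hnr hsplit fun ℓ _ hne hmult ↦ hm ⟨ℓ, ‹_›, hne, hmult⟩
  · exact Three.missingUpperBoundAt_of_surj_nonsplit_of_schneiderNonsplit W hKato hJn hHn hDf hGZK hpar
      hX hsurj hsplit (hSchN W hX hnr hsurj hsplit)

/-- **The `KolyvaginRoadThree` twin** (same statement, same proof term).
[cite: Disegni2020, Thm. 1 (§1.2) = Thm. 4 (§3.2)] [cite: Wuthrich2014, Thm. 3, Cor. 19]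
[cite: SteinWuthrich2013, Thm. 6.1, §4.2] -/
theorem kolyvaginRoadThree_eulerHalvesAtThree_of_conjectureWithM_of_threeOnly_of_schneider
    (hKato : kato_charIdeal_dvd_multiplicative_of_surjective) (hJs : thm61_splitMultiplicative)
    (hJn : thm61_nonsplitMultiplicative) (hHs : exists_isSplitMultCanonical)
    (hHn : exists_isMultCanonical) (hDf : Disegni2020.thm1_padicBSD_rankOne_multiplicative)
    (hGZK : rank_eq_analyticRank_of_analyticRank_le_one) (hpar : nonempty_modularParametrizationData)
    (hCm : ∀ (W : WeierstrassCurve ℚ) [W.IsElliptic] [W.IsGloballyMinimal], ClassX11b W 3 → Surj W 3 →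
      W.HasSplitMultiplicativeReductionAtPrime 3 →
        (∃ ℓ : ℕ, ∃ _ : Fact ℓ.Prime, ℓ ≠ 3 ∧ W.HasMultiplicativeReductionAtPrime ℓ) →
          ClassClosure.RelativeExceptionalLeadingTermAt W 3)
    (h₃ : ∀ (W : WeierstrassCurve ℚ) [W.IsElliptic] [W.IsGloballyMinimal], ClassX11b W 3 → Surj W 3 →
      ¬ Ram W 3 → W.HasSplitMultiplicativeReductionAtPrime 3 →
        (∀ (ℓ : ℕ) [Fact ℓ.Prime], ℓ ≠ 3 → ¬ W.HasMultiplicativeReductionAtPrime ℓ) →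
          Typed.MissingUpperBoundAt W 3)
    (hSchS : ∀ (W : WeierstrassCurve ℚ) [W.IsElliptic] [W.IsGloballyMinimal], ClassX11b W 3 → Surj W 3 →
      W.HasSplitMultiplicativeReductionAtPrime 3 → ∀ (Dq : TateParameterData W 3) (Dh : PAdicHeightData W 3),
        IsSplitMultCanonical Dh Dq → SchneiderConjecture Dh)
    (hSchN : ∀ (W : WeierstrassCurve ℚ) [W.IsElliptic] [W.IsGloballyMinimal], ClassX11b W 3 → ¬ Ram W 3 →
      Surj W 3 → ¬ W.HasSplitMultiplicativeReductionAtPrime 3 →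
        ∀ (q : ℚ_[3]) (Dh : PAdicHeightData W 3), q ≠ 0 → ‖q‖ < 1 → tateJ q = (W.j : ℚ_[3]) →
          IsMultCanonical Dh q → SchneiderConjecture Dh) :
    Summit.BirchSwinnertonDyer.BirchSwinnertonDyer.Theses.KolyvaginRoadThree.EulerHalvesAtThree :=
  classRecordThree_eulerHalvesAtThree_of_conjectureWithM_of_threeOnly_of_schneider hKato hJs hJn hHs hHn
    hDf hGZK hpar hCm h₃ hSchS hSchN

/-- **`PublishedInputsThree` packaging** (item 19112, BY NAME: conjuncts 6, 15, 16, 17, 18) + the three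
published facts the class record does not carry + conj@3-WITH-m + the `3`-only residue + rung I1 at `3`
bundled (`ClassClosure.RegulatorNonvanishingAt W 3` on X11b@3 ∩ `Surj`) ⟹ the crux — the shape of a
line `EulerHalvesAtThree_of (h : PublishedInputsThree)`. CONDITIONAL; nothing booked.
[cite: Disegni2020, Thm. 1 (§1.2) = Thm. 4 (§3.2)] [cite: Wuthrich2014, Thm. 3, Cor. 19]
[cite: SteinWuthrich2013, Thm. 6.1, §4.2, Conj. 4.1] -/
theorem classRecordThree_eulerHalvesAtThree_of_publishedInputs_of_conjectureWithM_of_threeOnly_of_regulatorNonvanishing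
    (h : Summit.BirchSwinnertonDyer.BirchSwinnertonDyer.Theses.ClassRecordThree.PublishedInputsThree)
    (hKato : kato_charIdeal_dvd_multiplicative_of_surjective) (hJs : thm61_splitMultiplicative)
    (hHs : exists_isSplitMultCanonical)
    (hCm : ∀ (W : WeierstrassCurve ℚ) [W.IsElliptic] [W.IsGloballyMinimal], ClassX11b W 3 → Surj W 3 →
      W.HasSplitMultiplicativeReductionAtPrime 3 →
        (∃ ℓ : ℕ, ∃ _ : Fact ℓ.Prime, ℓ ≠ 3 ∧ W.HasMultiplicativeReductionAtPrime ℓ) →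
          ClassClosure.RelativeExceptionalLeadingTermAt W 3)
    (h₃ : ∀ (W : WeierstrassCurve ℚ) [W.IsElliptic] [W.IsGloballyMinimal], ClassX11b W 3 → Surj W 3 →
      ¬ Ram W 3 → W.HasSplitMultiplicativeReductionAtPrime 3 →
        (∀ (ℓ : ℕ) [Fact ℓ.Prime], ℓ ≠ 3 → ¬ W.HasMultiplicativeReductionAtPrime ℓ) →
          Typed.MissingUpperBoundAt W 3)
    (hReg : ∀ (W : WeierstrassCurve ℚ) [W.IsElliptic] [W.IsGloballyMinimal], ClassX11b W 3 → Surj W 3 →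
      ClassClosure.RegulatorNonvanishingAt W 3) :
    Summit.BirchSwinnertonDyer.BirchSwinnertonDyer.Theses.ClassRecordThree.EulerHalvesAtThree := by
  obtain ⟨-, -, -, -, -, hGZK, -, -, -, -, -, -, -, -, hJn, hHn, hDf, hpar, -, -⟩ := h
  exact classRecordThree_eulerHalvesAtThree_of_conjectureWithM_of_threeOnly_of_schneider hKato hJs hJn hHs
    hHn hDf hGZK hpar hCm h₃ (fun W _ _ hX hsurj _ ↦ (hReg W hX hsurj).2)
    (fun W _ _ hX _ hsurj _ ↦ (hReg W hX hsurj).1)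

end Crux

/-! ### §3 The rung-K2@3 leaf keyed on conj@3-WITH-m -/

section Leaf

/-- **Rung-K2@3 leaf `X11b.MultiplicativeRankOneAtThree` from `SchneiderAtThree` + `HalvesAtThreeR` +
`HsiehDescentAtThree` + `CornerAtThree` + `PublishedInputsThree` BY NAME and the exceptional-zero
road keyed on conj@3-WITH-m** — crux 5 `EulerHalvesAtThree` and the five Shimura supports of `closes`
replaced (as in p552549) by: three further PUBLISHED facts (`hKato`, `hJs`, `hHs`); the audited display
`hCm` on split X11b@3 ∩ `Surj` pairs WITH a multiplicative `ℓ ≠ 3`; the `3`-ONLY residue `h₃` (Euler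
half on split ¬(ram) ∩ `Surj` pairs with NO such `ℓ`; idle on the census's TRUE-OPEN B10 classes);
the split Schneider half on split `Surj` pairs (`hSchS`) and the non-split half on non-split ¬(ram)
`Surj` pairs (`hSchN`). The three (ram) binders `hUβ`, `hUα`, `hUγ` of the kernel class record
`multiplicativeRankOneAtThree_of_classRecord_upperB` take `hCm` only (a (ram) witness is a second prime
and gives `Surj`); `hU₀` takes `hCm` ∕ `h₃` ∕ the non-split road. CONDITIONAL on every binder; nothing
booked. [cite: Disegni2020, Thm. 1 (§1.2) = Thm. 4 (§3.2), Prop. 5] [cite: Wuthrich2014, Thm. 3 (p. 383), Cor. 19]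
[cite: SteinWuthrich2013, Thm. 6.1, §4.2] [cite: MazurTateTeitelbaum1986Invent, §II.10]
[cite: Miller2011LMS, Def. 1.1] -/
theorem multiplicativeRankOneAtThree_of_cruxes_of_conjectureWithM_of_threeOnly_of_schneider
    (h₁ : SchneiderAtThree) (h₂ : HalvesAtThreeR) (h₃' : HsiehDescentAtThree) (h₅ : CornerAtThree)
    (h₆ : PublishedInputsThree)
    (hKato : kato_charIdeal_dvd_multiplicative_of_surjective) (hJs : thm61_splitMultiplicative)
    (hHs : exists_isSplitMultCanonical)
    (hCm : ∀ (W : WeierstrassCurve ℚ) [W.IsElliptic] [W.IsGloballyMinimal], ClassX11b W 3 → Surj W 3 →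
      W.HasSplitMultiplicativeReductionAtPrime 3 →
        (∃ ℓ : ℕ, ∃ _ : Fact ℓ.Prime, ℓ ≠ 3 ∧ W.HasMultiplicativeReductionAtPrime ℓ) →
          ClassClosure.RelativeExceptionalLeadingTermAt W 3)
    (h₃ : ∀ (W : WeierstrassCurve ℚ) [W.IsElliptic] [W.IsGloballyMinimal], ClassX11b W 3 → Surj W 3 →
      ¬ Ram W 3 → W.HasSplitMultiplicativeReductionAtPrime 3 →
        (∀ (ℓ : ℕ) [Fact ℓ.Prime], ℓ ≠ 3 → ¬ W.HasMultiplicativeReductionAtPrime ℓ) →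
          Typed.MissingUpperBoundAt W 3)
    (hSchS : ∀ (W : WeierstrassCurve ℚ) [W.IsElliptic] [W.IsGloballyMinimal], ClassX11b W 3 → Surj W 3 →
      W.HasSplitMultiplicativeReductionAtPrime 3 → ∀ (Dq : TateParameterData W 3) (Dh : PAdicHeightData W 3),
        IsSplitMultCanonical Dh Dq → SchneiderConjecture Dh)
    (hSchN : ∀ (W : WeierstrassCurve ℚ) [W.IsElliptic] [W.IsGloballyMinimal], ClassX11b W 3 → ¬ Ram W 3 →
      Surj W 3 → ¬ W.HasSplitMultiplicativeReductionAtPrime 3 →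
        ∀ (q : ℚ_[3]) (Dh : PAdicHeightData W 3), q ≠ 0 → ‖q‖ < 1 → tateJ q = (W.j : ℚ_[3]) →
          IsMultCanonical Dh q → SchneiderConjecture Dh) :
    MultiplicativeRankOneAtThree := by
  obtain ⟨hGZ, hKo, hB, hSk, hWu, hGZK, hmod, hnf, hHL, hMaz, hPT, -, -, hSkA, hJn, hHn, hD, hpar, hMN,
    hH⟩ := h₆
  -- the Euler half on every SPLIT (ram) X11b@3 pair: conj@3-WITH-m, the (ram) prime being the second prime
  have hspR : ∀ (W : WeierstrassCurve ℚ) [W.IsElliptic] [W.IsGloballyMinimal], ClassX11b W 3 → Ram W 3 →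
      W.HasSplitMultiplicativeReductionAtPrime 3 → Typed.MissingUpperBoundAt W 3 :=
    fun W _ _ hX hram hsplit ↦
      have hsurj : Surj W 3 := surj_of_irr_of_ram W 3 hX.2.2.2 hram
      Three.missingUpperBoundAt_of_surj_split_of_secondPrime_of_conjectureWithM_of_schneiderSplit W hKato
        hJs hHs hGZK hpar hX hsurj hsplit (Three.exists_multiplicativePrime_ne_of_ram W hram) hCm
        (hSchS W hX hsurj hsplit)
  exact multiplicativeRankOneAtThree_of_classRecord_upperB hGZ hKo hB hSk hWu hGZK hmod hnf hHL hMaz hPT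
    hSkA hJn hHn hD hpar hMN hH h₁
    (fun W _ _ hX ↦ (h₃' W hX).1) (fun W _ _ hX ↦ (h₃' W hX).2)
    (fun W _ _ hX ↦ (h₂ W hX).1) (fun W _ _ hX ↦ (h₂ W hX).2)
    (fun W _ _ hX hram hsplit _ _ _ ↦ hspR W hX hram hsplit)
    (fun W _ _ hX hram hα ↦ hspR W hX hram hα.1)
    (fun W _ _ hX hram hsplit _ _ ↦ hspR W hX hram hsplit)
    (fun W _ _ hX hsurj hnr ↦ by
      by_cases hsplit : W.HasSplitMultiplicativeReductionAtPrime 3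
      · by_cases hm : ∃ ℓ : ℕ, ∃ _ : Fact ℓ.Prime, ℓ ≠ 3 ∧ W.HasMultiplicativeReductionAtPrime ℓ
        · exact Three.missingUpperBoundAt_of_surj_split_of_secondPrime_of_conjectureWithM_of_schneiderSplit
            W hKato hJs hHs hGZK hpar hX hsurj hsplit hm hCm (hSchS W hX hsurj hsplit)
        · exact h₃ W hX hsurj hnr hsplit fun ℓ _ hne hmult ↦ hm ⟨ℓ, ‹_›, hne, hmult⟩
      · exact Three.missingUpperBoundAt_of_surj_nonsplit_of_schneiderNonsplit W hKato hJn hHn hD hGZK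
          hpar hX hsurj hsplit (hSchN W hX hnr hsurj hsplit))
    (fun W _ _ ↦ (h₅ W).1) (fun W _ _ ↦ (h₅ W).2.1) (fun W _ _ ↦ (h₅ W).2.2)

/-- **Over the binders of `Theses.ClassRecordThree.closes` (rev 29)**: `HalvesAtThreeR` and
`HsiehDescentAtThree` derived exactly as `closes` derives them (`LZZKernel.bdpValueAt₃_of_thm151_thm153`,
`WaldspurgerKernel.hsiehDescentAt₃_of_thm54_of_tateSen`), then §3's leaf. On this road the route's open
content on the split ∧ (ram) B10 locus reads {`IMCDivTwoLociAtThreeR` (crux 20262), conj@3-WITH-m, one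
split REGMULT row per pair}. CONDITIONAL; nothing booked. [cite: LiuZhangZhang2018, Thm. 1.5.1, Thm. 1.5.3]
[cite: BertoliniDarmonPrasanna2013, Thm. 5.4] [cite: Disegni2020, Thm. 1 (§1.2) = Thm. 4 (§3.2)]
[cite: Wuthrich2014, Thm. 3, Cor. 19] [cite: SteinWuthrich2013, Thm. 6.1, §4.2] -/
theorem multiplicativeRankOneAtThree_of_closesBinders_of_conjectureWithM_of_threeOnly_of_schneider
    (h₁ : SchneiderAtThree) (hLZZ : LZZWaldspurgerHeegner) (h3R : IMCDivTwoLociAtThreeR)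
    (hTS : TateSenVanishingAtThree) (hW : BDPWaldspurgerSquare) (h₅ : CornerAtThree)
    (h₆ : PublishedInputsThree)
    (hKato : kato_charIdeal_dvd_multiplicative_of_surjective) (hJs : thm61_splitMultiplicative)
    (hHs : exists_isSplitMultCanonical)
    (hCm : ∀ (W : WeierstrassCurve ℚ) [W.IsElliptic] [W.IsGloballyMinimal], ClassX11b W 3 → Surj W 3 →
      W.HasSplitMultiplicativeReductionAtPrime 3 →
        (∃ ℓ : ℕ, ∃ _ : Fact ℓ.Prime, ℓ ≠ 3 ∧ W.HasMultiplicativeReductionAtPrime ℓ) →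
          ClassClosure.RelativeExceptionalLeadingTermAt W 3)
    (h₃ : ∀ (W : WeierstrassCurve ℚ) [W.IsElliptic] [W.IsGloballyMinimal], ClassX11b W 3 → Surj W 3 →
      ¬ Ram W 3 → W.HasSplitMultiplicativeReductionAtPrime 3 →
        (∀ (ℓ : ℕ) [Fact ℓ.Prime], ℓ ≠ 3 → ¬ W.HasMultiplicativeReductionAtPrime ℓ) →
          Typed.MissingUpperBoundAt W 3)
    (hSchS : ∀ (W : WeierstrassCurve ℚ) [W.IsElliptic] [W.IsGloballyMinimal], ClassX11b W 3 → Surj W 3 →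
      W.HasSplitMultiplicativeReductionAtPrime 3 → ∀ (Dq : TateParameterData W 3) (Dh : PAdicHeightData W 3),
        IsSplitMultCanonical Dh Dq → SchneiderConjecture Dh)
    (hSchN : ∀ (W : WeierstrassCurve ℚ) [W.IsElliptic] [W.IsGloballyMinimal], ClassX11b W 3 → ¬ Ram W 3 →
      Surj W 3 → ¬ W.HasSplitMultiplicativeReductionAtPrime 3 →
        ∀ (q : ℚ_[3]) (Dh : PAdicHeightData W 3), q ≠ 0 → ‖q‖ < 1 → tateJ q = (W.j : ℚ_[3]) →
          IsMultCanonical Dh q → SchneiderConjecture Dh) :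
    MultiplicativeRankOneAtThree := by
  have h₃' : HsiehDescentAtThree :=
    Summit.BirchSwinnertonDyer.BirchSwinnertonDyer.Theorems.WaldspurgerKernel.hsiehDescentAt₃_of_thm54_of_tateSen
      hW hTS
  have hV :=
    Summit.BirchSwinnertonDyer.BirchSwinnertonDyer.Theorems.LZZKernel.bdpValueAt₃_of_thm151_thm153 hLZZ
  have h₂ : HalvesAtThreeR := fun W _ _ hX ↦
    ⟨fun hram hsp ↦ ⟨hV W, (h3R W hX).1 hram hsp⟩, fun hnr hsurj ↦ ⟨hV W, (h3R W hX).2 hnr hsurj⟩⟩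
  exact multiplicativeRankOneAtThree_of_cruxes_of_conjectureWithM_of_threeOnly_of_schneider h₁ h₂ h₃' h₅ h₆
    hKato hJs hHs hCm h₃ hSchS hSchN

end Leaf

end Summit.BirchSwinnertonDyer.BirchSwinnertonDyer.Theorems.ExceptionalZeroRoad

end
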